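import Summits.ResolutionOfSingularities.ResolutionOfSingularities.Theorems.ConeExit.Negative.Mirror

/-!
# Calculus of the formal partial derivatives `pd k` (crux `NoPeriodicIsolatedAtom`, line `ridge_rank`,
# lead's stub `stub_unwind` — infrastructure file 1)

The route `FrobeniusClosing` states its cruxes over a raw coefficient calculus; its formal partial
derivative is the operator `pd k f = fun A => (A k + 1) * f (A + e_k)` on `MvPowerSeries (Fin n) κ`
(mirrored verbatim in `Theorems/ConeExit/Negative/Mirror.lean`, which we import). Mathlib has no
partial derivatives on multivariate power series, so this file proves the calculus the unwinding
argument needs, for that exact operator: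

* linearity (`pd_add`, `pd_sub`, `pd_neg`, `pd_zero`, `pd_sum`, `pd_C_mul`), values on generators
  (`pd_C`, `pd_one`, `pd_X_self`, `pd_X_of_ne`);
* the Leibniz rule `pd_mul` and its consequences `pd_pow_succ`, and in characteristic `p`:
  `pd_pow_char` (`∂(f^p) = 0`), `pd_unit_pow_char_mul` (`∂(v^p g) = v^p ∂g`);
* the FROBENIUS KERNEL: in characteristic `p` (prime), `∀ k, pd k F = 0` iff every coefficient of
  `F` at an exponent with some coordinate not divisible by `p` vanishes (`forall_pd_eq_zero_iff`).
-/

noncomputable section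

-- single-problem summit: the doubled namespace component is forced by the tree layout
set_option linter.dupNamespace false

namespace Summit.ResolutionOfSingularities.ResolutionOfSingularities.Theorems.NoPeriodicIsolatedAtom.Unwind

open Summit.ResolutionOfSingularities.ResolutionOfSingularities.Theorems.ConeExit.Negative (pd)
open scoped BigOperators
open MvPowerSeries

variable {n : ℕ} {κ : Type} [Field κ]

/-- Coefficients of `pd k f` (definitional). [folklore] -/
theorem coeff_pd (k : Fin n) (f : MvPowerSeries (Fin n) κ) (A : Fin n →₀ ℕ) :
    coeff A (pd k f) = ((A k + 1 : ℕ) : κ) * coeff (A + Finsupp.single k 1) f :=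
  rfl

/-- `pd k` is additive. [folklore] -/
theorem pd_add (k : Fin n) (f g : MvPowerSeries (Fin n) κ) : pd k (f + g) = pd k f + pd k g := by
  ext A; simp only [coeff_pd, map_add]; ring

/-- `pd k 0 = 0`. [folklore] -/
theorem pd_zero (k : Fin n) : pd k (0 : MvPowerSeries (Fin n) κ) = 0 := by
  ext A; simp [coeff_pd]

/-- `pd k (-f) = - pd k f`. [folklore] -/
theorem pd_neg (k : Fin n) (f : MvPowerSeries (Fin n) κ) : pd k (-f) = -pd k f := by
  ext A; simp only [coeff_pd, map_neg]; ring

/-- `pd k` respects subtraction. [folklore] -/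
theorem pd_sub (k : Fin n) (f g : MvPowerSeries (Fin n) κ) : pd k (f - g) = pd k f - pd k g := by
  rw [sub_eq_add_neg, pd_add, pd_neg, ← sub_eq_add_neg]

/-- `pd k` commutes with finite sums. [folklore] -/
theorem pd_sum {ι : Type} (k : Fin n) (s : Finset ι) (f : ι → MvPowerSeries (Fin n) κ) :
    pd k (∑ x ∈ s, f x) = ∑ x ∈ s, pd k (f x) := by
  classical
  induction s using Finset.induction_on with
  | empty => simp [pd_zero]
  | insert a s ha ih => rw [Finset.sum_insert ha, Finset.sum_insert ha, pd_add, ih]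

/-- `pd k` is `κ`-linear: constants pass through. [folklore] -/
theorem pd_C_mul (k : Fin n) (c : κ) (f : MvPowerSeries (Fin n) κ) :
    pd k (C c * f) = C c * pd k f := by
  ext A; simp only [coeff_pd, coeff_C_mul]; ring

/-- Constants have zero derivative. [folklore] -/
theorem pd_C (k : Fin n) (c : κ) : pd k (C c : MvPowerSeries (Fin n) κ) = 0 := by
  ext A
  rw [coeff_pd, coeff_C, if_neg, mul_zero, map_zero]
  intro h
  have := congrArg (fun B : Fin n →₀ ℕ => B k) h
  simp at this

/-- `pd k 1 = 0`. [folklore] -/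
theorem pd_one (k : Fin n) : pd k (1 : MvPowerSeries (Fin n) κ) = 0 := by
  rw [← map_one (C (σ := Fin n) (R := κ)), pd_C]

/-- `pd k (X k) = 1`. [folklore] -/
theorem pd_X_self (k : Fin n) : pd k (X k : MvPowerSeries (Fin n) κ) = 1 := by
  ext A
  rw [coeff_pd, coeff_X, coeff_one]
  by_cases hA : A = 0
  · subst hA; simp
  · rw [if_neg, if_neg hA, mul_zero]
    intro h
    apply hA
    have h' : A + Finsupp.single k 1 = 0 + Finsupp.single k 1 := by rw [zero_add]; exact h
    exact add_right_cancel h'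

/-- `pd k (X l) = 0` for `l ≠ k`. [folklore] -/
theorem pd_X_of_ne {k l : Fin n} (h : l ≠ k) : pd k (X l : MvPowerSeries (Fin n) κ) = 0 := by
  ext A
  rw [coeff_pd, coeff_X, if_neg, mul_zero, map_zero]
  intro hA
  have := congrArg (fun B : Fin n →₀ ℕ => B k) hA
  simp [h] at this

/-! ## The Leibniz rule -/

/-- Half of the Leibniz bookkeeping: the `B k`-weighted convolution over the antidiagonal of
`A + e_k` is the convolution of `pd k f` with `g` over the antidiagonal of `A`. [folklore] -/
theorem sum_antidiagonal_fst_weight (k : Fin n) (f g : MvPowerSeries (Fin n) κ) (A : Fin n →₀ ℕ) :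
    ∑ x ∈ Finset.HasAntidiagonal.antidiagonal (A + Finsupp.single k 1), (((x.1 : Fin n →₀ ℕ) k : ℕ) : κ) * (coeff x.1 f * coeff x.2 g) =
      ∑ x ∈ Finset.HasAntidiagonal.antidiagonal A, coeff x.1 (pd k f) * coeff x.2 g := by
  classical
  -- the injection `(B, C) ↦ (B + e_k, C)`
  set ι : (Fin n →₀ ℕ) × (Fin n →₀ ℕ) → (Fin n →₀ ℕ) × (Fin n →₀ ℕ) :=
    fun x => (x.1 + Finsupp.single k 1, x.2) with hι
  have hinj : Set.InjOn ι (Finset.HasAntidiagonal.antidiagonal A : Set _) := by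
    intro x _ y _ hxy
    simp only [hι, Prod.mk.injEq] at hxy
    exact Prod.ext (add_right_cancel hxy.1) hxy.2
  -- terms outside the image have weight `B k = 0`
  have hsplit : ∑ x ∈ Finset.HasAntidiagonal.antidiagonal (A + Finsupp.single k 1),
      (((x.1 : Fin n →₀ ℕ) k : ℕ) : κ) * (coeff x.1 f * coeff x.2 g) =
      ∑ x ∈ (Finset.HasAntidiagonal.antidiagonal A).image ι, (((x.1 : Fin n →₀ ℕ) k : ℕ) : κ) * (coeff x.1 f * coeff x.2 g) := by
    symm
    apply Finset.sum_subset
    · intro x hx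
      rw [Finset.mem_image] at hx
      obtain ⟨y, hy, rfl⟩ := hx
      rw [Finset.HasAntidiagonal.mem_antidiagonal] at hy ⊢
      simp only [hι, ← hy]
      abel
    · intro x hx hnot
      have hk : x.1 k = 0 := by
        by_contra hne
        apply hnot
        rw [Finset.mem_image]
        refine ⟨(x.1 - Finsupp.single k 1, x.2), ?_, ?_⟩
        · rw [Finset.HasAntidiagonal.mem_antidiagonal] at hx ⊢
          have hle : Finsupp.single k 1 ≤ x.1 := by
            rw [Finsupp.single_le_iff]; omega
          show x.1 - Finsupp.single k 1 + x.2 = A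
          have h2 : x.1 - Finsupp.single k 1 + x.2 + Finsupp.single k 1 = A + Finsupp.single k 1 := by
            rw [add_right_comm, tsub_add_cancel_of_le hle, hx]
          exact add_right_cancel h2
        · simp only [hι]
          have hle : Finsupp.single k 1 ≤ x.1 := by
            rw [Finsupp.single_le_iff]; omega
          rw [tsub_add_cancel_of_le hle]
      rw [hk, Nat.cast_zero, zero_mul]
  rw [hsplit, Finset.sum_image hinj]
  refine Finset.sum_congr rfl fun x _ => ?_
  simp only [hι, coeff_pd, Finsupp.add_apply, Finsupp.single_eq_same]
  ring

/-- **Leibniz rule** for `pd k`. [folklore] -/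
theorem pd_mul (k : Fin n) (f g : MvPowerSeries (Fin n) κ) :
    pd k (f * g) = pd k f * g + f * pd k g := by
  classical
  ext A
  rw [coeff_pd, coeff_mul, map_add, coeff_mul, coeff_mul, Finset.mul_sum]
  -- split the weight `A k + 1 = B k + C k` on the antidiagonal of `A + e_k`
  have hw : ∀ x ∈ Finset.HasAntidiagonal.antidiagonal (A + Finsupp.single k 1),
      ((A k + 1 : ℕ) : κ) * (coeff x.1 f * coeff x.2 g) =
        (((x.1 : Fin n →₀ ℕ) k : ℕ) : κ) * (coeff x.1 f * coeff x.2 g) + (((x.2 : Fin n →₀ ℕ) k : ℕ) : κ) * (coeff x.1 f * coeff x.2 g) := by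
    intro x hx
    rw [Finset.HasAntidiagonal.mem_antidiagonal] at hx
    have : x.1 k + x.2 k = A k + 1 := by
      have := congrArg (fun B : Fin n →₀ ℕ => B k) hx
      simpa using this
    rw [← add_mul, ← Nat.cast_add, this]
  rw [Finset.sum_congr rfl hw, Finset.sum_add_distrib, sum_antidiagonal_fst_weight]
  congr 1
  -- the symmetric half: swap the factors
  have hswap : ∑ x ∈ Finset.HasAntidiagonal.antidiagonal (A + Finsupp.single k 1),
      (((x.2 : Fin n →₀ ℕ) k : ℕ) : κ) * (coeff x.1 f * coeff x.2 g) =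
      ∑ x ∈ Finset.HasAntidiagonal.antidiagonal (A + Finsupp.single k 1), (((x.1 : Fin n →₀ ℕ) k : ℕ) : κ) * (coeff x.1 g * coeff x.2 f) := by
    conv_lhs => rw [← Finset.HasAntidiagonal.map_swap_antidiagonal, Finset.sum_map]
    refine Finset.sum_congr rfl fun x _ => ?_
    simp only [Function.Embedding.coeFn_mk, Prod.fst_swap, Prod.snd_swap]
    ring
  rw [hswap, sum_antidiagonal_fst_weight]
  conv_rhs => rw [← Finset.HasAntidiagonal.map_swap_antidiagonal, Finset.sum_map]
  refine Finset.sum_congr rfl fun x _ => ?_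
  simp only [Function.Embedding.coeFn_mk, Prod.fst_swap, Prod.snd_swap]
  ring

/-- Derivative of a power: `∂(f^(m+1)) = (m+1) f^m ∂f`. [folklore] -/
theorem pd_pow_succ (k : Fin n) (f : MvPowerSeries (Fin n) κ) (m : ℕ) :
    pd k (f ^ (m + 1)) = ((m + 1 : ℕ) : MvPowerSeries (Fin n) κ) * f ^ m * pd k f := by
  induction m with
  | zero => simp
  | succ m ih =>
    rw [pow_succ, pd_mul, ih]
    push_cast
    ring

/-- In characteristic `p`, `p`-th powers have zero derivative. [folklore] -/
theorem pd_pow_char (p : ℕ) [hp : Fact p.Prime] [CharP κ p] (k : Fin n) (f : MvPowerSeries (Fin n) κ) :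
    pd k (f ^ p) = 0 := by
  obtain ⟨m, hm⟩ : ∃ m, p = m + 1 := ⟨p - 1, (Nat.succ_pred_eq_of_pos hp.out.pos).symm⟩
  rw [hm, pd_pow_succ, ← hm]
  have : ((p : ℕ) : MvPowerSeries (Fin n) κ) = 0 := by
    rw [← map_natCast (C (σ := Fin n) (R := κ)), CharP.cast_eq_zero, map_zero]
  rw [this, zero_mul, zero_mul]

/-- In characteristic `p`, `∂(v^p · g) = v^p · ∂g`. [folklore] -/
theorem pd_pow_char_mul (p : ℕ) [Fact p.Prime] [CharP κ p] (k : Fin n)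
    (v g : MvPowerSeries (Fin n) κ) : pd k (v ^ p * g) = v ^ p * pd k g := by
  rw [pd_mul, pd_pow_char, zero_mul, zero_add]

/-! ## The Frobenius kernel -/

/-- **Frobenius kernel of the partial derivatives.** In characteristic `p` (prime), all partial
derivatives of `F` vanish iff `F` is supported on exponents all of whose coordinates are divisible
by `p`. [folklore] -/
theorem forall_pd_eq_zero_iff (p : ℕ) [Fact p.Prime] [CharP κ p] (F : MvPowerSeries (Fin n) κ) :
    (∀ k, pd k F = 0) ↔ ∀ A : Fin n →₀ ℕ, (∃ j, ¬ p ∣ A j) → coeff A F = 0 := by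
  constructor
  · rintro h A ⟨j, hj⟩
    have hAj : 1 ≤ A j := by
      rcases Nat.eq_zero_or_pos (A j) with h0 | h0
      · exact absurd (h0 ▸ dvd_zero p) hj
      · exact h0
    have hle : Finsupp.single j 1 ≤ A := by rwa [Finsupp.single_le_iff]
    have hc := congrArg (coeff (A - Finsupp.single j 1)) (h j)
    rw [coeff_pd, map_zero, tsub_add_cancel_of_le hle] at hc
    have hcast : ((((A - Finsupp.single j 1 : Fin n →₀ ℕ) j) + 1 : ℕ) : κ) ≠ 0 := by
      have hAeq : ((A - Finsupp.single j 1 : Fin n →₀ ℕ) j) + 1 = A j := by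
        simp only [Finsupp.tsub_apply, Finsupp.single_eq_same]; omega
      rw [hAeq, Ne, CharP.cast_eq_zero_iff κ p]
      exact hj
    exact (mul_eq_zero.mp hc).resolve_left hcast
  · intro h k
    ext A
    rw [coeff_pd, map_zero]
    by_cases hdiv : p ∣ A k + 1
    · rw [(CharP.cast_eq_zero_iff κ p _).mpr hdiv, zero_mul]
    · rw [h (A + Finsupp.single k 1) ⟨k, by simpa using hdiv⟩, mul_zero]

/-- A series in the Frobenius kernel has zero coefficient at every exponent of total degree not
divisible by `p` (some coordinate is then not divisible by `p`). [folklore] -/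
theorem coeff_eq_zero_of_forall_pd_eq_zero_of_not_dvd_degree (p : ℕ) [Fact p.Prime] [CharP κ p]
    (F : MvPowerSeries (Fin n) κ) (hF : ∀ k, pd k F = 0) (A : Fin n →₀ ℕ)
    (hA : ¬ p ∣ A.degree) : coeff A F = 0 := by
  refine (forall_pd_eq_zero_iff p F).mp hF A ?_
  by_contra hall
  push Not at hall
  apply hA
  rw [Finsupp.degree_eq_sum]
  exact Finset.dvd_sum fun j _ => hall j

/-- **Registered helper goal `unwind_pd_leibniz`** (the Leibniz rule, in closed form; this is the
statement the file is registered under on the crux item). [folklore] -/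
theorem unwind_pd_leibniz : ∀ {n : ℕ} {κ : Type} [Field κ] (k : Fin n) (f g : MvPowerSeries (Fin n) κ),
    pd k (f * g) = pd k f * g + f * pd k g :=
  fun k f g => pd_mul k f g

end Summit.ResolutionOfSingularities.ResolutionOfSingularities.Theorems.NoPeriodicIsolatedAtom.Unwind

end
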